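import Literature.MathematicalPhysics.KineticTheory.ReyBelletThomas2002TwoScaleCells
import Literature.MathematicalPhysics.KineticTheory.ReyBelletThomas2002Thm310
import HarnessLib

/-!
# Rey-Bellet–Thomas 2002, Theorem 3.10 for `k₁ < k₂` (two time scales) and Theorem 2.1, proved

Trunk T-KINETIC (Literature/MathematicalPhysics/KineticTheory). Rey-Bellet–Thomas, CMP **225** (2002),
Theorem 3.10 — for `s > 0` and `0 < θ < 1/max(T_L, T_R)` there are a compact `U`, `κ < 1` and `L`
with `T^s e^{θG}(x) ≤ κ e^{θG(x)} + L 1_U(x)` — for the constructed kernels `rbKernel` of (RBT-SDE)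
under H1–H2 with pinning exponent `k₁` STRICTLY SMALLER than the interaction exponent `k₂`. The
printed proof (single time scale `E^{1/k₂-1/2}`, Thm 3.3) does not cover this regime: a rigidly
pinned high-energy configuration dissipates `o(E^{3/k₂-1/2})` over a time `E^{1/k₂-1/2}`; the gap —
shared by Carmona, SPA 117 (2007) — is pointed out and repaired for Langevin thermostats by
Cuneo–Eckmann–Hairer–Rey-Bellet, EJP **23** (2018) §5 with a STATE-DEPENDENT time scale: cells of
length `~ t_i = E^{1/k₂-1/2}` while the kinetic+interaction energy dominates and of length
`~ t_p = E^{1/k₁-1/2}` while the pinning energy dominates (Prop. 5.3, Cor. 5.4). This file carries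
that repair over to the Rey-Bellet–Thomas reservoirs, with one simplification that removes the
strong Markov property at the random cell ends from the argument: the cells are read on a UNIFORM
fine grid (spacing `τ ∈ [Λ₀t_i, 2Λ₀t_i]`, a pinning window being `m = ⌈Λ₀t_p/τ⌉` consecutive fine
cells) and the whole dissipation bound is PATHWISE on the event that every fine cell has a small
Brownian increment (the window increments are then small by the triangle inequality,
`m · m₁E^{1/k₂} ≤ 3m₁E^{1/k₁}`) and every fine-grid energy lies in `[E/2, 3E/2]`:

* `twoScale_accounting` — the elementary bookkeeping: along a monotone sequence, unit steps gaining
  `d_i` and `m`-steps gaining `d_p` accumulate `≥ min(d_i, d_p/m)·(J - m)`;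
* `norm_rbEta_pairShift_window_le`, `rbFlow_rbSolMap_pairShift`, `exists_nat_mul_le` — the window
  noise bound, the flow cocycle at grid times, covering of a window by fine cells;
* `rb_grid_dissipation_ge_twoScale` — **the pathwise two-scale dissipation bound** from the two
  cell cores (`ReyBelletThomas2002TwoScaleCells.lean`) and the cell energy bound;
* `rb_lintegral_exp_rbEnergy_small_twoScale` — `E_x e^{θG(x(s))} ≤ ½ e^{θG(x)}` for `G(x)` large
  (the probabilistic part is VERBATIM that of the tree's `k₁ = k₂` proof,
  `ReyBelletThomas2002Thm310.lean`: exponential supermartingale (41), restart with (26), Chebyshev,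
  Hölder, Brownian oscillation tails);
* `OscillatorChain.rb_thm310_twoScale` (Thm 3.10 for `k₁ < k₂`), `OscillatorChain.rb_thm310'`
  (Thm 3.10 for all `2 ≤ k₁ ≤ k₂`) and — with Prop. 4.2, Hörmander's theorem and the §5 assembly
  already in the tree — `ReyBelletThomas2002_thm21_holds : ReyBelletThomas2002_thm21`.

## References

* L. Rey-Bellet, L. E. Thomas, Comm. Math. Phys. **225** (2002) 305–329, Thm 3.10 (pp. 22–24),
  eqs. (39)–(42); Thm 3.3, Cor 3.6; Thm 2.1.
* N. Cuneo, J.-P. Eckmann, M. Hairer, L. Rey-Bellet, Electron. J. Probab. **23** (2018) no. 55,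
  §5: Thm 5.1, (5.7), Prop. 5.3, Cor. 5.4, Lemmas 5.5–5.6, Remark 5.12, §5.1–5.2 (arXiv:1712.09413).
* P. Carmona, Stoch. Proc. Appl. **117** (2007) 1076–1092, §5 (same single-scale gap).
-/

noncomputable section

open MeasureTheory ProbabilityTheory Filter Topology Set Metric Finset
open scoped NNReal ENNReal Topology

namespace Literature.MathematicalPhysics.KineticTheory.HeatConduction

open Literature.Probability.Process Literature.Analysis.ODE Literature.MathematicalPhysics.KineticTheory

variable {N : ℕ}

/-! ### Bookkeeping: two-scale accounting, window covering -/

/-- **Two-scale accounting.** Let `Γ : ℕ → ℝ` be monotone (the dissipation at the fine-grid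
times), `reg j` the regime at grid time `j`, and suppose every unit step from a `reg` time `j < J`
gains `d_i` and every `m`-step (`m ≥ 1`) from a non-`reg` time `j` with `j + m ≤ J` gains `d_p`.
Then for `0 ≤ ρ ≤ d_i` with `m ρ ≤ d_p`, `Γ J - Γ 0 ≥ ρ (J - m)` (walk along the variable-length
cells; the last, possibly incomplete, window is discarded). [cite: ReyBelletThomas2002, Thm 3.10 (proof, p. 24)] -/
theorem twoScale_accounting {Γ : ℕ → ℝ} {reg : ℕ → Prop} {J m : ℕ} {ρ dᵢ dₚ : ℝ} (hm : 1 ≤ m)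
    (hρ0 : 0 ≤ ρ) (hρi : ρ ≤ dᵢ) (hρp : (m : ℝ) * ρ ≤ dₚ) (hmono : Monotone Γ)
    (hi : ∀ j, j < J → reg j → dᵢ ≤ Γ (j + 1) - Γ j)
    (hp : ∀ j, j + m ≤ J → ¬ reg j → dₚ ≤ Γ (j + m) - Γ j) :
    ρ * ((J : ℝ) - m) ≤ Γ J - Γ 0 := by
  -- by strong induction on `n = J - j`
  have key : ∀ n : ℕ, ∀ j : ℕ, j + n = J → ρ * ((n : ℝ) - m) ≤ Γ J - Γ j := by
    intro n
    induction n using Nat.strong_induction_on with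
    | _ n ih =>
      intro j hj
      by_cases hnm : n ≤ m
      · have h1 : ρ * ((n : ℝ) - m) ≤ 0 :=
          mul_nonpos_of_nonneg_of_nonpos hρ0 (sub_nonpos.2 (by exact_mod_cast hnm))
        have h2 : Γ j ≤ Γ J := hmono (by omega)
        linarith
      · have hnm' : m < n := not_le.1 hnm
        by_cases hr : reg j
        · have h1 := hi j (by omega) hr
          have h2 := ih (n - 1) (by omega) (j + 1) (by omega)
          have e : ((n - 1 : ℕ) : ℝ) = n - 1 := by
            rw [Nat.cast_sub (by omega), Nat.cast_one]
          rw [e] at h2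
          nlinarith
        · have h1 := hp j (by omega) hr
          have h2 := ih (n - m) (by omega) (j + m) (by omega)
          have e : ((n - m : ℕ) : ℝ) = n - m := Nat.cast_sub hnm'.le
          rw [e] at h2
          nlinarith
  have := key J 0 (by simp)
  simpa using this

/-- **Covering a window by fine cells**: every `s ∈ [0, mτ]` (`τ > 0`, `m ≥ 1`) lies in some
`[lτ, (l+1)τ]` with `l < m`. [folklore] -/
theorem exists_nat_mul_le {τ s : ℝ} (hτ : 0 < τ) (hs0 : 0 ≤ s) {m : ℕ} (hm : 1 ≤ m) (hs : s ≤ m * τ) :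
    ∃ l : ℕ, l < m ∧ (l : ℝ) * τ ≤ s ∧ s ≤ ((l : ℝ) + 1) * τ := by
  set l₀ : ℕ := ⌊s / τ⌋₊ with hl₀
  have h1 : (l₀ : ℝ) ≤ s / τ := Nat.floor_le (div_nonneg hs0 hτ.le)
  have h2 : s / τ < l₀ + 1 := Nat.lt_floor_add_one _
  rw [le_div_iff₀ hτ] at h1
  rw [div_lt_iff₀ hτ] at h2
  by_cases hlm : l₀ < m
  · exact ⟨l₀, hlm, h1, h2.le⟩
  · have hml : m ≤ l₀ := not_lt.1 hlm
    refine ⟨m - 1, by omega, ?_, ?_⟩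
    · have : ((m - 1 : ℕ) : ℝ) * τ ≤ (l₀ : ℝ) * τ := by
        refine mul_le_mul_of_nonneg_right ?_ hτ.le
        exact_mod_cast (Nat.sub_le m 1).trans hml
      linarith
    · have e : (((m - 1 : ℕ) : ℝ) + 1) = m := by
        rw [Nat.cast_sub hm, Nat.cast_one]; ring
      rw [e]; exact hs

/-! ### The reservoir noise over a window and the flow cocycle at grid times -/

namespace OscillatorChain

variable (P : OscillatorChain)

/-- **The shifted reservoir noise over a window of `m` fine cells is small** when every fine cell
in the window is good: if `θ_{(j+l)τ} ω ∈ goodPaths a τ` for all `l < m`, then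
`‖η(θ_{jτ} ω)(u)‖ ≤ m · max(√(2γT_L), √(2γT_R)) a` for `u ∈ [0, mτ]` (telescoping over the fine
cells and the triangle inequality). [folklore] -/
theorem norm_rbEta_pairShift_window_le (N : ℕ) (T_L T_R : ℝ) {τ : ℝ} (hτ : 0 < τ) {a : ℝ}
    {ω : WienerPair} {j m : ℕ}
    (hgood : ∀ l : ℕ, l < m → pairShift ((((j + l : ℕ) : ℝ) * τ).toNNReal) ω ∈ goodPaths a τ.toNNReal)
    {u : ℝ} (hu0 : 0 ≤ u) (hu : u ≤ m * τ) :
    ‖P.rbEta N T_L T_R (pairShift ((((j : ℕ) : ℝ) * τ).toNNReal) ω) u‖ ≤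
      m * (max (Real.sqrt (2 * P.γ * T_L)) (Real.sqrt (2 * P.γ * T_R)) * a) := by
  set c : ℝ := max (Real.sqrt (2 * P.γ * T_L)) (Real.sqrt (2 * P.γ * T_R)) * a with hc
  set f : ℝ → ℝ × ℝ := P.rbEta N T_L T_R (pairPath ω) with hf
  have hjτ : ∀ i : ℕ, (0 : ℝ) ≤ (i : ℝ) * τ := fun i => by positivity
  -- the shifted noise in terms of `f`
  have hshift : ∀ (i : ℕ) {t : ℝ}, 0 ≤ t →
      P.rbEta N T_L T_R (pairShift ((((i : ℕ) : ℝ) * τ).toNNReal) ω) t = f ((i : ℝ) * τ + t) - f ((i : ℝ) * τ) := by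
    intro i t ht
    rw [P.rbEta_pairShift N T_L T_R _ ω ht, Real.coe_toNNReal _ (hjτ i)]
  -- one fine cell
  have hone : ∀ l : ℕ, l < m → ∀ t : ℝ, 0 ≤ t → t ≤ τ →
      ‖f (((j + l : ℕ) : ℝ) * τ + t) - f (((j + l : ℕ) : ℝ) * τ)‖ ≤ c := by
    intro l hl t ht0 ht
    rw [← hshift (j + l) ht0]
    exact P.norm_rbEta_pairShift_le N T_L T_R (hgood l hl) ht0 (by rwa [Real.coe_toNNReal _ hτ.le])
  -- the degenerate window `m = 0`
  rcases Nat.eq_zero_or_pos m with hm0 | hmpos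
  · subst hm0
    have hu' : u = 0 := by
      have : u ≤ 0 := by simpa using hu
      linarith
    subst hu'
    rw [hshift j le_rfl, add_zero, sub_self, norm_zero]
    simp
  have hc0 : 0 ≤ c := (norm_nonneg _).trans (hone 0 hmpos 0 le_rfl hτ.le)
  -- telescoping by induction on the number of complete fine cells
  have htel : ∀ l : ℕ, l ≤ m → ∀ t : ℝ, 0 ≤ t → t ≤ l * τ →
      ‖f ((j : ℝ) * τ + t) - f ((j : ℝ) * τ)‖ ≤ l * c := by
    intro l
    induction l with
    | zero =>
      intro _ t ht0 ht
      have : t = 0 := by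
        have : t ≤ 0 := by simpa using ht
        linarith
      subst this
      simp
    | succ l ih =>
      intro hl t ht0 ht
      by_cases htl : t ≤ l * τ
      · have h := ih (by omega) t ht0 htl
        have : (l : ℝ) * c ≤ ((l + 1 : ℕ) : ℝ) * c := by
          refine mul_le_mul_of_nonneg_right ?_ hc0
          push_cast; linarith
        exact h.trans this
      · have htl' : (l : ℝ) * τ < t := not_le.1 htl
        have e : f ((j : ℝ) * τ + t) - f ((j : ℝ) * τ) =
            (f (((j + l : ℕ) : ℝ) * τ + (t - l * τ)) - f (((j + l : ℕ) : ℝ) * τ)) +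
              (f ((j : ℝ) * τ + l * τ) - f ((j : ℝ) * τ)) := by
          have e1 : ((j + l : ℕ) : ℝ) * τ + (t - l * τ) = (j : ℝ) * τ + t := by push_cast; ring
          have e2 : ((j + l : ℕ) : ℝ) * τ = (j : ℝ) * τ + l * τ := by push_cast; ring
          rw [e1, e2]; abel
        rw [e]
        refine (norm_add_le _ _).trans ?_
        have h1 := hone l (by omega) (t - l * τ) (by linarith) (by push_cast at ht; linarith)
        have h2 := ih (by omega) (l * τ) (by positivity) le_rfl
        calc ‖f (((j + l : ℕ) : ℝ) * τ + (t - l * τ)) - f (((j + l : ℕ) : ℝ) * τ)‖ +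
              ‖f ((j : ℝ) * τ + l * τ) - f ((j : ℝ) * τ)‖ ≤ c + l * c := add_le_add h1 h2
          _ = ((l + 1 : ℕ) : ℝ) * c := by push_cast; ring
  rw [hshift j hu0]
  exact htel m le_rfl u hu0 hu

variable {P} {k₁ k₂ : ℝ} (hU : RBGrowth P.U k₁) (hV : RBGrowth P.V k₂)
  (hk₁ : 1 ≤ k₁) (hk₂ : 1 ≤ k₂) (hγ : 0 ≤ P.γ) (Λ : ℝ) (N : ℕ) (T_L T_R : ℝ)
include hU hV hk₁ hk₂ hγ

-- the flow is a limit of Picard iterations: never let the unifier unfold it (heartbeats)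
attribute [local irreducible] OscillatorChain.rbFlow

/-- **The flow cocycle at grid times**: restarting at `Φ_s(x, B(ω))` with the shifted reservoir
noise reproduces the solution map, `Φ_u(Φ_s(x, B(ω)), η(θ_s ω)) = Φ_{s+u}(x, B(ω))` (`u ≥ 0`).
[folklore] -/
theorem rbFlow_rbSolMap_pairShift (x : RBPhaseSpace N) (s : ℝ≥0) {u : ℝ} (hu : 0 ≤ u) (ω : WienerPair) :
    P.rbFlow Λ N (P.rbSolMap Λ N T_L T_R s x (pairPath ω)) (P.rbEta N T_L T_R (pairShift s ω)) u =
      P.rbSolMap Λ N T_L T_R (s + u) x (pairPath ω) := by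
  have hηc : Continuous (P.rbEta N T_L T_R (pairPath ω)) := P.continuous_rbEta N T_L T_R _
  rw [P.rbSolMap_eq_rbFlow, P.rbSolMap_eq_rbFlow,
    OscillatorChain.rbFlow_add hU hV hk₁ hk₂ hγ Λ N x hηc s.coe_nonneg hu]
  refine rbFlow_congr hU hV hk₁ hk₂ hγ Λ N _ (P.continuous_rbEta N T_L T_R _) ?_ (t := u) ?_
    ⟨hu, le_rfl⟩
  · exact (hηc.comp (continuous_const_add _)).sub continuous_const
  · intro r hr
    exact P.rbEta_pairShift N T_L T_R s ω hr.1

end OscillatorChain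

/-! ### The pathwise two-scale dissipation bound along the fine grid -/

section GridTwoScale

variable {P : OscillatorChain} {k₁ k₂ : ℝ} (hU : RBGrowth P.U k₁) (hV : RBGrowth P.V k₂)
  (hk₁ : 1 ≤ k₁) (hk₂ : 1 ≤ k₂) (hγ : 0 ≤ P.γ) (Λ : ℝ) (N : ℕ) (T_L T_R : ℝ)
include hU hV hk₁ hk₂ hγ

-- the flow is a limit of Picard iterations: never let the unifier unfold it (heartbeats)
attribute [local irreducible] OscillatorChain.rbFlow

/-- **The pathwise two-scale dissipation bound** (CEHR Prop. 5.3 + Cor. 5.4 made deterministic on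
a fine grid). Inputs: the interaction cell core `hFi` (scale `k₂`, regime `H_pin ≤ H_int`), the
pinning cell core `hFp` (scale `k₁`, regime `H_int ≤ H_pin`), the fine-cell energy bound `hcell`;
a fine spacing `τ ∈ [Λ₀t_i, 2Λ₀t_i]`, a window of `m ≥ 1` fine cells with `mτ ≥ Λ₀t_p`, noise
thresholds `c_max m' ≤ m₀E^{1/k₂}`, `m₀ ≤ δ_i`, `m · c_max m' ≤ δ_p E^{1/k₁}`. If every fine-grid
energy `G(z_{jτ})`, `j < J`, lies in `[E/2, 3E/2]` and every fine cell has a good Brownian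
increment, then `Γ(Jτ) ≥ (J - m) · min(γε_iE^{3/k₂-1/2}, γε_pE^{3/k₁-1/2}/m)`: unit steps from an
interaction-regime grid point gain `γε_iE^{3/k₂-1/2}`, `m`-steps from a pinning-regime grid point
gain `γε_pE^{3/k₁-1/2}` (the window noise is small by `norm_rbEta_pairShift_window_le`, the
window energy stays `≤ 2E` fine cell by fine cell via the cocycle `rbFlow_rbSolMap_pairShift`),
and `twoScale_accounting` sums them. [cite: ReyBelletThomas2002, Thm 3.10 (proof, p. 24)] -/
theorem rb_grid_dissipation_ge_twoScale {Λ₀ εi δi Ei εp δp Ep m₀ E₁ : ℝ}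
    (hFi : ∀ ⦃E : ℝ⦄, Ei ≤ E → ∀ ⦃τ : ℝ⦄, Λ₀ * timeScale k₂ E ≤ τ →
      ∀ x : RBPhaseSpace N, E / 2 ≤ P.rbEnergy N x → P.pinEnergy N x.1.1 ≤ P.intEnergy N x.1 →
        ∀ ⦃η : ℝ → ℝ × ℝ⦄, Continuous η → η 0 = 0 → (∀ s ∈ Icc 0 τ, ‖η s‖ ≤ δi * E ^ (1 / k₂)) →
          (∀ s ∈ Icc 0 τ, P.rbEnergy N (P.rbFlow Λ N x η s) ≤ 4 * E) →
            εi * E ^ (3 / k₂ - 1 / 2) ≤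
              ∫ s in (0 : ℝ)..τ, ((P.rbFlow Λ N x η s).2.1 ^ 2 + (P.rbFlow Λ N x η s).2.2 ^ 2))
    (hFp : ∀ ⦃E : ℝ⦄, Ep ≤ E → ∀ ⦃τ : ℝ⦄, Λ₀ * timeScale k₁ E ≤ τ →
      ∀ x : RBPhaseSpace N, E / 2 ≤ P.rbEnergy N x → P.intEnergy N x.1 ≤ P.pinEnergy N x.1.1 →
        ∀ ⦃η : ℝ → ℝ × ℝ⦄, Continuous η → η 0 = 0 → (∀ s ∈ Icc 0 τ, ‖η s‖ ≤ δp * E ^ (1 / k₁)) →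
          (∀ s ∈ Icc 0 τ, P.rbEnergy N (P.rbFlow Λ N x η s) ≤ 4 * E) →
            εp * E ^ (3 / k₁ - 1 / 2) ≤
              ∫ s in (0 : ℝ)..τ, ((P.rbFlow Λ N x η s).2.1 ^ 2 + (P.rbFlow Λ N x η s).2.2 ^ 2))
    (hcell : ∀ ⦃E : ℝ⦄, E₁ ≤ E → ∀ ⦃τ : ℝ⦄, 0 ≤ τ → τ ≤ 2 * Λ₀ * timeScale k₂ E →
      ∀ x : RBPhaseSpace N, P.rbEnergy N x ≤ 3 * E / 2 →
        ∀ ⦃η : ℝ → ℝ × ℝ⦄, Continuous η → (∀ s ∈ Icc 0 τ, ‖η s‖ ≤ m₀ * E ^ (1 / k₂)) →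
          ∀ s ∈ Icc 0 τ, P.rbEnergy N (P.rbFlow Λ N x η s) ≤ 2 * E)
    (hεi : 0 ≤ εi) (hεp : 0 ≤ εp)
    {E τ m' : ℝ} {m : ℕ} (hEi : Ei ≤ E) (hEp : Ep ≤ E) (hE1 : E₁ ≤ E) (hE : 0 ≤ E) (hτ0 : 0 < τ)
    (hτ1 : Λ₀ * timeScale k₂ E ≤ τ) (hτ2 : τ ≤ 2 * Λ₀ * timeScale k₂ E)
    (hm1 : 1 ≤ m) (hmτ : Λ₀ * timeScale k₁ E ≤ m * τ)
    (hnoise : max (Real.sqrt (2 * P.γ * T_L)) (Real.sqrt (2 * P.γ * T_R)) * m' ≤ m₀ * E ^ (1 / k₂))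
    (hnoise_i : m₀ ≤ δi)
    (hnoise_p : (m : ℝ) * (max (Real.sqrt (2 * P.γ * T_L)) (Real.sqrt (2 * P.γ * T_R)) * m') ≤ δp * E ^ (1 / k₁))
    (x : RBPhaseSpace N) (J : ℕ) (ω : WienerPair)
    (hgrid : ∀ j : ℕ, j < J → E / 2 ≤ P.rbEnergy N (P.rbSolMap Λ N T_L T_R (j * τ) x (pairPath ω)) ∧
      P.rbEnergy N (P.rbSolMap Λ N T_L T_R (j * τ) x (pairPath ω)) ≤ 3 * E / 2)
    (hgood : ∀ j : ℕ, j < J → pairShift ((j : ℝ) * τ).toNNReal ω ∈ goodPaths m' τ.toNNReal) :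
    ((J : ℝ) - m) * min (P.γ * (εi * E ^ (3 / k₂ - 1 / 2))) (P.γ * (εp * E ^ (3 / k₁ - 1 / 2)) / m) ≤
      P.rbDissipation Λ N x (P.rbEta N T_L T_R (pairPath ω)) (J * τ) := by
  set cmax : ℝ := max (Real.sqrt (2 * P.γ * T_L)) (Real.sqrt (2 * P.γ * T_R)) with hcmax
  set η₀ := P.rbEta N T_L T_R (pairPath ω) with hη₀
  have hη₀c : Continuous η₀ := P.continuous_rbEta N T_L T_R _
  set G := P.rbEnergy N with hGdef
  -- grid states, shifted noises and the dissipation at grid times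
  set z : ℕ → RBPhaseSpace N := fun j => P.rbSolMap Λ N T_L T_R (j * τ) x (pairPath ω) with hz
  set ηs : ℕ → ℝ → ℝ × ℝ := fun j => P.rbEta N T_L T_R (pairShift ((j : ℝ) * τ).toNNReal ω) with hηs
  set Γ : ℕ → ℝ := fun j => P.rbDissipation Λ N x η₀ (j * τ) with hΓ
  have hjτ : ∀ j : ℕ, (0 : ℝ) ≤ (j : ℝ) * τ := fun j => by positivity
  have hsj : ∀ j : ℕ, ((((j : ℝ) * τ).toNNReal : ℝ≥0) : ℝ) = j * τ := fun j => Real.coe_toNNReal _ (hjτ j)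
  have hηsc : ∀ j, Continuous (ηs j) := fun j => P.continuous_rbEta N T_L T_R _
  have hηs0 : ∀ j, ηs j 0 = 0 := fun j => by
    simp only [hηs]
    rw [P.rbEta_of_continuous N T_L T_R (continuous_pairShift_fst (s := ((j : ℝ) * τ).toNNReal) ω)
      (continuous_pairShift_snd (s := ((j : ℝ) * τ).toNNReal) ω)]
    simp
  -- dissipation increments are cell dissipations of the restarted flows
  have hincr : ∀ (j n : ℕ), Γ (j + n) - Γ j = P.rbDissipation Λ N (z j) (ηs j) (n * τ) := by
    intro j n
    have h := rbDissipation_pairShift hU hV hk₁ hk₂ hγ Λ N T_L T_R x (((j : ℝ) * τ).toNNReal)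
      (u := n * τ) (by positivity) ω
    rw [hsj] at h
    have e : ((j + n : ℕ) : ℝ) * τ = j * τ + n * τ := by push_cast; ring
    simp only [hΓ, hz, hηs]
    rw [e, h]
    ring
  have hmono : Monotone Γ := by
    intro a b hab
    simp only [hΓ]
    exact OscillatorChain.rbDissipation_mono hU hV hk₁ hk₂ hγ Λ N x hη₀c
      (mul_le_mul_of_nonneg_right (by exact_mod_cast hab) hτ0.le)
  -- the flow restarted at a grid point agrees with the global solution map
  have hcoc : ∀ (j : ℕ) {u : ℝ}, 0 ≤ u →
      P.rbFlow Λ N (z j) (ηs j) u = P.rbSolMap Λ N T_L T_R (j * τ + u) x (pairPath ω) := by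
    intro j u hu
    have h := OscillatorChain.rbFlow_rbSolMap_pairShift hU hV hk₁ hk₂ hγ Λ N T_L T_R x
      (((j : ℝ) * τ).toNNReal) hu ω
    rw [hsj] at h
    exact h
  -- fine-cell noise bound
  have hcellnoise : ∀ j : ℕ, j < J → ∀ s ∈ Icc 0 τ, ‖ηs j s‖ ≤ m₀ * E ^ (1 / k₂) := by
    intro j hj s hs
    have h := P.norm_rbEta_pairShift_le N T_L T_R (hgood j hj) hs.1
      (by rw [Real.coe_toNNReal']; exact le_max_of_le_left hs.2)
    exact h.trans hnoise
  -- fine-cell energy bound: `G ≤ 2E` on the cell after a grid point with energy `≤ 3E/2`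
  have hcellE : ∀ j : ℕ, j < J → ∀ s ∈ Icc 0 τ, G (P.rbFlow Λ N (z j) (ηs j) s) ≤ 2 * E :=
    fun j hj s hs => hcell hE1 hτ0.le hτ2 (z j) (hgrid j hj).2 (hηsc j) (hcellnoise j hj) s hs
  -- (i) unit steps in the interaction regime
  have hi : ∀ j, j < J → P.pinEnergy N (z j).1.1 ≤ P.intEnergy N (z j).1 →
      P.γ * (εi * E ^ (3 / k₂ - 1 / 2)) ≤ Γ (j + 1) - Γ j := by
    intro j hj hreg
    rw [hincr j 1, Nat.cast_one, one_mul]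
    have hηb : ∀ s ∈ Icc 0 τ, ‖ηs j s‖ ≤ δi * E ^ (1 / k₂) := fun s hs =>
      (hcellnoise j hj s hs).trans (mul_le_mul_of_nonneg_right hnoise_i (Real.rpow_nonneg hE _))
    have hEc : ∀ s ∈ Icc 0 τ, G (P.rbFlow Λ N (z j) (ηs j) s) ≤ 4 * E := fun s hs =>
      (hcellE j hj s hs).trans (by linarith)
    have h5 := hFi hEi hτ1 (z j) (hgrid j hj).1 hreg (hηsc j) (hηs0 j) hηb hEc
    show P.γ * (εi * E ^ (3 / k₂ - 1 / 2)) ≤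
      P.γ * ∫ s in (0:ℝ)..τ, ((P.rbFlow Λ N (z j) (ηs j) s).2.1 ^ 2 + (P.rbFlow Λ N (z j) (ηs j) s).2.2 ^ 2)
    exact mul_le_mul_of_nonneg_left h5 hγ
  -- (ii) `m`-steps in the pinning regime
  have hp : ∀ j, j + m ≤ J → ¬ (P.pinEnergy N (z j).1.1 ≤ P.intEnergy N (z j).1) →
      P.γ * (εp * E ^ (3 / k₁ - 1 / 2)) ≤ Γ (j + m) - Γ j := by
    intro j hjm hreg
    have hreg' : P.intEnergy N (z j).1 ≤ P.pinEnergy N (z j).1.1 := (not_le.1 hreg).le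
    rw [hincr j m]
    have hmτ0 : (0 : ℝ) ≤ m * τ := by positivity
    -- window noise
    have hηb : ∀ s ∈ Icc 0 ((m : ℝ) * τ), ‖ηs j s‖ ≤ δp * E ^ (1 / k₁) := by
      intro s hs
      have h := P.norm_rbEta_pairShift_window_le N T_L T_R hτ0 (a := m') (ω := ω) (j := j) (m := m)
        (fun l hl => hgood (j + l) (by omega)) hs.1 hs.2
      exact h.trans hnoise_p
    -- window energy
    have hEc : ∀ s ∈ Icc 0 ((m : ℝ) * τ), G (P.rbFlow Λ N (z j) (ηs j) s) ≤ 4 * E := by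
      intro s hs
      obtain ⟨l, hl, hls, hsl⟩ := exists_nat_mul_le hτ0 hs.1 hm1 hs.2
      have hjl : j + l < J := by omega
      have e1 := hcoc j hs.1
      have e2 := hcoc (j + l) (u := s - l * τ) (by linarith)
      have e3 : ((j + l : ℕ) : ℝ) * τ + (s - l * τ) = j * τ + s := by push_cast; ring
      rw [e3] at e2
      rw [e1, ← e2]
      have := hcellE (j + l) hjl (s - l * τ) ⟨by linarith, by linarith⟩
      linarith
    have h5 := hFp hEp hmτ (z j) (hgrid j (by omega)).1 hreg' (hηsc j) (hηs0 j) hηb hEc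
    show P.γ * (εp * E ^ (3 / k₁ - 1 / 2)) ≤
      P.γ * ∫ s in (0:ℝ)..((m : ℝ) * τ), ((P.rbFlow Λ N (z j) (ηs j) s).2.1 ^ 2 + (P.rbFlow Λ N (z j) (ηs j) s).2.2 ^ 2)
    exact mul_le_mul_of_nonneg_left h5 hγ
  -- the accounting
  set dᵢ : ℝ := P.γ * (εi * E ^ (3 / k₂ - 1 / 2)) with hdᵢ
  set dₚ : ℝ := P.γ * (εp * E ^ (3 / k₁ - 1 / 2)) with hdₚ
  have hdᵢ0 : 0 ≤ dᵢ := by rw [hdᵢ]; exact mul_nonneg hγ (mul_nonneg hεi (Real.rpow_nonneg hE _))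
  have hdₚ0 : 0 ≤ dₚ := by rw [hdₚ]; exact mul_nonneg hγ (mul_nonneg hεp (Real.rpow_nonneg hE _))
  have hm0 : (0 : ℝ) < m := by exact_mod_cast hm1
  set ρ : ℝ := min dᵢ (dₚ / m) with hρ
  have hρ0 : 0 ≤ ρ := le_min hdᵢ0 (div_nonneg hdₚ0 hm0.le)
  have hρp : (m : ℝ) * ρ ≤ dₚ := by
    calc (m : ℝ) * ρ ≤ m * (dₚ / m) := mul_le_mul_of_nonneg_left (min_le_right _ _) hm0.le
      _ = dₚ := by field_simp
  have hacc := twoScale_accounting (Γ := Γ) (reg := fun j => P.pinEnergy N (z j).1.1 ≤ P.intEnergy N (z j).1)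
    hm1 hρ0 (min_le_left _ _) hρp hmono hi hp
  have hΓ0 : Γ 0 = 0 := by
    simp only [hΓ, Nat.cast_zero, zero_mul]
    exact OscillatorChain.rbDissipation_zero P Λ N x η₀
  rw [hΓ0, sub_zero, mul_comm] at hacc
  exact hacc

end GridTwoScale


/-! ### The high-energy estimate for `k₁ < k₂`: `E_x e^{θG(x(s)) - θG(x)} → 0` -/

section MainTwoScale

variable {P : OscillatorChain} {k₁ k₂ : ℝ} (hU : RBGrowth P.U k₁) (hV : RBGrowth P.V k₂)
  (hk₁2 : 2 ≤ k₁) (hk : k₁ < k₂) (hγ : 0 < P.γ) {Λ : ℝ} (hΛ : Λ ≠ 0) (hN : 0 < N)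
  {T_L T_R : ℝ} (hTL : 0 < T_L) (hTR : 0 < T_R) {θ : ℝ} (hθ : 0 < θ) (hθ' : θ < 1 / max T_L T_R)
include hU hV hk₁2 hk hγ hΛ hN hTL hTR hθ hθ'

-- the flow is a limit of Picard iterations: never let the unifier unfold it (heartbeats)
attribute [local irreducible] OscillatorChain.rbFlow

set_option maxHeartbeats 400000 in
/-- **Theorem 3.10, qualitative high-energy form, for `2 ≤ k₁ < k₂`** (`γ > 0`, `Λ ≠ 0`, `N ≥ 1`,
`T_L, T_R > 0`, `0 < θ < 1/T_max`, `s > 0`): there is `E₀` such that for every start `x` with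
`G(x) ≥ E₀`, `E_x e^{θG(x(s))} ≤ ½ e^{θG(x)}`. Proof: the two-scale grid decomposition of the module
docstring — fine cells `τ ∈ [Λ₀t_i, 2Λ₀t_i]` (`Λ₀ = s/4`), pinning windows of `m = ⌈Λ₀t_p/τ⌉` fine
cells; off the bad events (a fine-grid energy `< E/2` or `> 3E/2`, a large Brownian increment on a
fine cell) the path dissipates `Γ(s) ≥ γε₀E^{2/k₂}/6` (`rb_grid_dissipation_ge_twoScale`); the
bad events and the exponential supermartingale are estimated exactly as for `k₁ = k₂`
(`rb_lintegral_exp_rbEnergy_small`). [cite: ReyBelletThomas2002, Thm 3.10 eqs. (41)–(42)] -/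
theorem rb_lintegral_exp_rbEnergy_small_twoScale {tstar : ℝ} (hts : 0 < tstar) :
    ∃ E₀ : ℝ, ∀ x : RBPhaseSpace N, E₀ ≤ P.rbEnergy N x →
      ∫⁻ ω, ENNReal.ofReal (Real.exp (θ * P.rbEnergy N
          (P.rbSolMap Λ N T_L T_R tstar x (pairPath ω)))) ∂wienerPair ≤
        ENNReal.ofReal (Real.exp (θ * P.rbEnergy N x) / 2) := by
  have hk1 : 1 ≤ k₁ := by linarith
  have hk2 : 1 ≤ k₂ := by linarith
  have hk₂2 : 2 < k₂ := lt_of_le_of_lt hk₁2 hk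
  have hk0 : 0 < k₂ := by linarith
  have hk10 : 0 < k₁ := by linarith
  have hγ0 : 0 ≤ P.γ := hγ.le
  have hTm : 0 < max T_L T_R := lt_max_of_lt_left hTL
  have hθT : θ * max T_L T_R < 1 := (lt_div_iff₀ hTm).1 hθ'
  -- constants of the estimate
  set κ : ℝ := θ * (1 - θ * max T_L T_R) with hκ
  have hκ0 : 0 < κ := mul_pos hθ (by linarith only [hθT])
  set Cst : ℝ := P.γ * (T_L + T_R) * θ with hCst
  have hCst0 : 0 ≤ Cst := by positivity
  -- the Hölder exponent: `1 < p`, `pθ < 1/T_max`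
  set p : ℝ := (1 + 1 / (θ * max T_L T_R)) / 2 with hp
  have hθT0 : 0 < θ * max T_L T_R := by positivity
  have hp1 : 1 < p := by
    rw [hp]
    have : 1 < 1 / (θ * max T_L T_R) := by rw [lt_div_iff₀ hθT0]; linarith only [hθT]
    linarith only [this]
  have hpθ : p * θ < 1 / max T_L T_R := by
    rw [lt_div_iff₀ hTm, hp]
    have h1 : (1 + 1 / (θ * max T_L T_R)) / 2 * θ * max T_L T_R = (θ * max T_L T_R + 1) / 2 := by
      field_simp
    calc (1 + 1 / (θ * max T_L T_R)) / 2 * θ * max T_L T_R = (θ * max T_L T_R + 1) / 2 := h1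
      _ < 1 := by linarith only [hθT]
  have hpq := Real.HolderConjugate.conjExponent hp1
  set q := Real.conjExponent p with hq
  have hq0 : 0 < 1 / q := by have := hpq.symm.pos; positivity
  -- the macroscopic cell length `Λ₀ = s/4` and the deterministic inputs
  set Λ₀ : ℝ := tstar / 4 with hΛ₀
  have hΛ₀0 : 0 < Λ₀ := by positivity
  obtain ⟨Ei, δi, εi, hEi1, hδi, hεi, hFi⟩ :=
    OscillatorChain.rb_cell_dissipation_ge_interaction hU hV hk₁2 hk hγ0 hΛ hN hΛ₀0
  obtain ⟨Ep, δp, εp, hEp1, hδp, hεp, hFp⟩ :=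
    OscillatorChain.rb_cell_dissipation_ge_pinning hU hV hk₁2 hk hγ0 hΛ hN hΛ₀0
  obtain ⟨m₀, E₁, hm₀, -, hE₁1, hcell⟩ :=
    OscillatorChain.rb_cell_energy_le₂ hU hV hk1 hk2 hγ0 Λ (N := N) (k := k₂) (by linarith) hΛ₀0
  -- a common noise threshold `m₀' = min m₀ (min δ_i (δ_p/3))` and a common dissipation constant
  set m₀' : ℝ := min m₀ (min δi (δp / 3)) with hm₀'
  have hm₀'0 : 0 < m₀' := lt_min hm₀ (lt_min hδi (by positivity))
  have hm₀'m : m₀' ≤ m₀ := min_le_left _ _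
  have hm₀'i : m₀' ≤ δi := (min_le_right _ _).trans (min_le_left _ _)
  have hm₀'p : 3 * m₀' ≤ δp := by
    have : m₀' ≤ δp / 3 := (min_le_right _ _).trans (min_le_right _ _)
    linarith only [this]
  set ε₀ : ℝ := min εi εp with hε₀
  have hε₀0 : 0 < ε₀ := lt_min hεi hεp
  have hcell' : ∀ ⦃E : ℝ⦄, E₁ ≤ E → ∀ ⦃τ : ℝ⦄, 0 ≤ τ → τ ≤ 2 * Λ₀ * timeScale k₂ E →
      ∀ x : RBPhaseSpace N, P.rbEnergy N x ≤ 3 * E / 2 →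
        ∀ ⦃η : ℝ → ℝ × ℝ⦄, Continuous η → (∀ s ∈ Icc 0 τ, ‖η s‖ ≤ m₀' * E ^ (1 / k₂)) →
          ∀ s ∈ Icc 0 τ, P.rbEnergy N (P.rbFlow Λ N x η s) ≤ 2 * E := by
    intro E hE τ hτ0 hτ x hx η hηc hηb
    have hE0 : 0 ≤ E := by linarith
    exact hcell hE hτ0 hτ x hx hηc fun s hs => (hηb s hs).trans
      (mul_le_mul_of_nonneg_right hm₀'m (Real.rpow_nonneg hE0 _))
  set cmax : ℝ := max (Real.sqrt (2 * P.γ * T_L)) (Real.sqrt (2 * P.γ * T_R)) with hcmax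
  have hcmax0 : 0 ≤ cmax := le_max_of_le_left (Real.sqrt_nonneg _)
  set m₁ : ℝ := m₀' / (cmax + 1) with hm₁
  have hm₁0 : 0 < m₁ := by positivity
  have hm₁le : cmax * m₁ ≤ m₀' := by
    rw [hm₁, mul_div_assoc']
    rw [div_le_iff₀ (by positivity)]
    nlinarith only [hcmax0, hm₀'0]
  -- the bound function and its decay
  set C₂ : ℝ := 256 * Λ₀ ^ 2 / m₁ ^ 4 with hC₂
  set Bf : ℝ → ℝ := fun E => Real.exp (Cst * tstar) * Real.exp (-(κ * P.γ * ε₀ / 6 * E ^ (2 / k₂))) +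
      (4 * E + 1) * Real.exp (Cst * tstar) * Real.exp (-(θ / 2 * E)) +
      Real.exp (Cst * tstar) * ((4 * E + 1) * Real.exp (Cst * tstar) * Real.exp (-(θ / 2 * E)) +
        C₂ * E ^ (-(2 / k₂))) ^ (1 / q) with hBf
  have hBf0 : Tendsto Bf atTop (𝓝 0) := by
    have h1 : Tendsto (fun E : ℝ => Real.exp (Cst * tstar) * Real.exp (-(κ * P.γ * ε₀ / 6 * E ^ (2 / k₂))))
        atTop (𝓝 0) := by
      have := (tendsto_exp_neg_mul_rpow (κ := κ * P.γ * ε₀ / 6) (b := 2 / k₂) (by positivity)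
        (by positivity)).const_mul (Real.exp (Cst * tstar))
      simpa using this
    have h2 : Tendsto (fun E : ℝ => (4 * E + 1) * Real.exp (Cst * tstar) * Real.exp (-(θ / 2 * E))) atTop (𝓝 0) := by
      have := (tendsto_linear_mul_exp_neg (c := 4) (by norm_num) (κ := θ / 2) (by positivity)).const_mul
        (Real.exp (Cst * tstar))
      rw [mul_zero] at this
      refine this.congr fun E => ?_
      ring
    have h3 : Tendsto (fun E : ℝ => C₂ * E ^ (-(2 / k₂))) atTop (𝓝 0) :=
      tendsto_const_mul_rpow_neg _ (by positivity)
    have h4 := ((h2.add h3).rpow_const (Or.inr hq0.le)).const_mul (Real.exp (Cst * tstar))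
    rw [add_zero, Real.zero_rpow hq0.ne', mul_zero] at h4
    have := (h1.add h2).add h4
    simpa only [add_zero] using this
  -- thresholds
  have hb1 : 0 < 1 / 2 + 1 / k₂ := by positivity
  have hsm : Tendsto (fun E : ℝ => tstar * E ^ (-(1 / 2 + 1 / k₂))) atTop (𝓝 0) :=
    tendsto_const_mul_rpow_neg _ hb1
  have hev : ∀ᶠ E : ℝ in atTop, Bf E < 1 / 2 ∧ max (max Ei Ep) E₁ ≤ E ∧ 1 ≤ E ∧
      tstar * E ^ (-(1 / 2 + 1 / k₂)) < m₁ ^ 2 := by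
    refine ((tendsto_order.1 hBf0).2 _ (by norm_num)).and ((eventually_ge_atTop _).and
      ((eventually_ge_atTop _).and (hsm.eventually_lt_const (by positivity))))
  obtain ⟨A, hA⟩ := Filter.eventually_atTop.1 hev
  set A' : ℝ := max A 1 with hA'
  refine ⟨A', fun x hx => ?_⟩
  ----------------------------------------------------------------
  -- Step 1: the energy `E = G(x)`, the time scale and the grid
  ----------------------------------------------------------------
  set E : ℝ := P.rbEnergy N x with hE
  obtain ⟨hBa, hmaxE, hE1, hsmall⟩ := hA E ((le_max_left _ _).trans hx)
  have hE0 : 0 < E := by linarith only [hE1]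
  have hEEi : Ei ≤ E := ((le_max_left _ _).trans (le_max_left _ _)).trans hmaxE
  have hEEp : Ep ≤ E := ((le_max_right _ _).trans (le_max_left _ _)).trans hmaxE
  have hEE₁ : E₁ ≤ E := (le_max_right _ _).trans hmaxE
  set tE : ℝ := timeScale k₂ E with htE
  have htE0 : 0 < tE := timeScale_pos k₂ hE0
  have htE1 : tE ≤ 1 := Real.rpow_le_one_of_one_le_of_nonpos hE1 (by
    have : 1 / k₂ ≤ 1 / 2 := by rw [div_le_div_iff₀ hk0 (by norm_num)]; linarith
    linarith)
  -- the pinning time scale `t_p = E^{1/k₁-1/2} ∈ [t_E, 1]`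
  set tP : ℝ := timeScale k₁ E with htP
  have htP0 : 0 < tP := timeScale_pos k₁ hE0
  have htP1 : tP ≤ 1 := Real.rpow_le_one_of_one_le_of_nonpos hE1 (by
    have : 1 / k₁ ≤ 1 / 2 := by rw [div_le_div_iff₀ hk10 (by norm_num)]; linarith
    linarith)
  have htEP : tE ≤ tP := Real.rpow_le_rpow_of_exponent_le hE1 (by
    have : 1 / k₂ ≤ 1 / k₁ := one_div_le_one_div_of_le hk10 hk.le
    linarith)
  -- the grid: `r = s/(Λ₀ t_E) = 4/t_E ≥ 4`, `J = ⌊r⌋`, `τ = s/J ∈ [Λ₀ t_E, 2Λ₀ t_E]`, `Jτ = s`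
  set r : ℝ := tstar / (Λ₀ * tE) with hr
  have hr4 : r = 4 / tE := by rw [hr, hΛ₀]; field_simp
  have hr2 : 4 ≤ r := by
    rw [hr4, le_div_iff₀ htE0]; linarith only [htE1]
  set J : ℕ := ⌊r⌋₊ with hJ
  have hJle : (J : ℝ) ≤ r := Nat.floor_le (by linarith only [hr2])
  have hJlt : r < J + 1 := Nat.lt_floor_add_one r
  have hJ1 : (1 : ℝ) ≤ J := by
    have : (1 : ℝ) < J := by linarith only [hr2, hJlt]
    exact this.le
  have hJpos : (0 : ℝ) < J := by linarith only [hJ1]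
  have hJne : (J : ℝ) ≠ 0 := hJpos.ne'
  set τ : ℝ := tstar / J with hτ
  have hτ0 : 0 < τ := div_pos hts hJpos
  have hJτ : (J : ℝ) * τ = tstar := by rw [hτ]; field_simp
  have hτ1 : Λ₀ * tE ≤ τ := by
    rw [hτ, le_div_iff₀ hJpos]
    have : (J : ℝ) * (Λ₀ * tE) ≤ tstar := by
      have := hJle; rw [hr, le_div_iff₀ (by positivity)] at this; linarith only [this]
    linarith only [this]
  have hτ2 : τ ≤ 2 * Λ₀ * tE := by
    rw [hτ, div_le_iff₀ hJpos]
    have h2J : r ≤ 2 * J := by linarith only [hJlt, hJ1, hr2]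
    rw [hr, div_le_iff₀ (by positivity)] at h2J
    linarith only [h2J]
  have hτt : τ ≤ tstar := by
    rw [hτ, div_le_iff₀ hJpos]; nlinarith only [hJ1, hts.le]
  have hjτ : ∀ j : ℕ, j < J + 1 → (j : ℝ) * τ ≤ tstar := fun j hj => by
    have : (j : ℝ) ≤ J := by exact_mod_cast Nat.lt_succ_iff.1 hj
    calc (j : ℝ) * τ ≤ J * τ := mul_le_mul_of_nonneg_right this hτ0.le
      _ = tstar := hJτ
  -- the pinning window: `m = ⌈Λ₀ t_p/τ⌉` fine cells, `Λ₀ t_p ≤ mτ ≤ Λ₀ t_p + τ`, `m t_E ≤ 3 t_p`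
  set m : ℕ := ⌈Λ₀ * tP / τ⌉₊ with hm
  have hmτ : Λ₀ * tP ≤ m * τ := by
    have h := Nat.le_ceil (Λ₀ * tP / τ)
    rw [div_le_iff₀ hτ0] at h
    exact h
  have hmτ' : (m : ℝ) * τ ≤ Λ₀ * tP + τ := by
    have h := (Nat.ceil_lt_add_one (by positivity : 0 ≤ Λ₀ * tP / τ)).le
    rw [← hm] at h
    have : (m : ℝ) * τ ≤ (Λ₀ * tP / τ + 1) * τ := mul_le_mul_of_nonneg_right h hτ0.le
    rw [add_mul, div_mul_cancel₀ _ hτ0.ne', one_mul] at this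
    exact this
  have hm1 : 1 ≤ m := by
    rw [hm, Nat.one_le_ceil_iff]; positivity
  have hm0 : (0 : ℝ) < m := by exact_mod_cast hm1
  have hmtE : (m : ℝ) * tE ≤ 3 * tP := by
    -- `m Λ₀ t_E ≤ m τ ≤ Λ₀ t_p + τ ≤ Λ₀ t_p + 2Λ₀ t_E ≤ 3 Λ₀ t_p`
    have h1 : (m : ℝ) * (Λ₀ * tE) ≤ m * τ := mul_le_mul_of_nonneg_left hτ1 hm0.le
    have h2 : (m : ℝ) * τ ≤ Λ₀ * tP + 2 * Λ₀ * tE := hmτ'.trans (by linarith only [hτ2])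
    have h3 : Λ₀ * ((m : ℝ) * tE) ≤ Λ₀ * (3 * tP) := by nlinarith only [h1, h2, htEP, hΛ₀0]
    exact le_of_mul_le_mul_left h3 hΛ₀0
  have hJm : Λ₀ ≤ ((J : ℝ) - m) * τ := by
    -- `(J - m)τ = s - mτ ≥ 4Λ₀ - (Λ₀ t_p + τ) ≥ 4Λ₀ - 3Λ₀`
    have : ((J : ℝ) - m) * τ = tstar - m * τ := by rw [sub_mul, hJτ]
    rw [this]
    have h2 : (m : ℝ) * τ ≤ Λ₀ * tP + 2 * Λ₀ * tE := hmτ'.trans (by linarith only [hτ2])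
    have h3 : Λ₀ * tP ≤ Λ₀ := mul_le_of_le_one_right hΛ₀0.le htP1
    have h4 : Λ₀ * tE ≤ Λ₀ := mul_le_of_le_one_right hΛ₀0.le htE1
    rw [hΛ₀] at h2 h3 h4 ⊢
    linarith only [h2, h3, h4]
  have hJm0 : 0 ≤ (J : ℝ) - m := by
    by_contra h
    have : ((J : ℝ) - m) * τ < 0 := mul_neg_of_neg_of_pos (not_le.1 h) hτ0
    linarith only [this, hJm, hΛ₀0]
  -- `J ≤ 4E` (`J ≤ 4/t_E = 4 E^{1/2-1/k₂} ≤ 4E`) and `J ≥ 2/t_E`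
  have hk' : (0 : ℝ) < 1 / k₂ := by positivity
  have htEE : 1 ≤ E * tE := by
    have hne : 1 + (1 / k₂ - 1 / 2) ≠ 0 := by intro h; linarith only [h, hk']
    rw [htE, timeScale, ← Real.rpow_one_add' hE0.le hne]
    exact Real.one_le_rpow hE1 (by linarith only [hk'])
  have hJr : (J : ℝ) ≤ 4 * E := by
    refine hJle.trans ?_
    rw [hr4, div_le_iff₀ htE0]
    nlinarith only [htEE]
  have hJlow : 2 / tE ≤ J := by
    have h1 : r - 1 ≤ J := by linarith only [hJlt]
    rw [hr4] at h1
    have h2 : 2 ≤ 2 / tE := by rw [le_div_iff₀ htE0]; linarith only [htE1]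
    have : 4 / tE = 2 / tE + 2 / tE := by ring
    linarith only [h1, h2, this]
  -- small-noise thresholds
  set m' : ℝ := m₁ * E ^ (1 / k₂) with hm'
  have hEk0 : 0 < E ^ (1 / k₂) := Real.rpow_pos_of_pos hE0 _
  have hm'0 : 0 ≤ m' := by positivity
  have hnoise : cmax * m' ≤ m₀' * E ^ (1 / k₂) := by
    rw [hm', ← mul_assoc]; exact mul_le_mul_of_nonneg_right hm₁le hEk0.le
  have hnoise_p : (m : ℝ) * (cmax * m') ≤ δp * E ^ (1 / k₁) := by
    -- `m · cmax m' ≤ m m₀' E^{1/k₂} ≤ 3 m₀' E^{1/k₂} t_p/t_E = 3 m₀' E^{1/k₁} ≤ δ_p E^{1/k₁}`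
    have hEk1 : E ^ (1 / k₂) * tP = E ^ (1 / k₁) * tE := by
      rw [htP, htE, timeScale, timeScale, ← Real.rpow_add hE0, ← Real.rpow_add hE0]
      congr 1; ring
    have h1 : (m : ℝ) * (cmax * m') ≤ m * (m₀' * E ^ (1 / k₂)) := mul_le_mul_of_nonneg_left hnoise hm0.le
    have h2 : (m : ℝ) * (m₀' * E ^ (1 / k₂)) * tE ≤ 3 * m₀' * (E ^ (1 / k₂) * tP) := by
      have := mul_le_mul_of_nonneg_left hmtE (by positivity : 0 ≤ m₀' * E ^ (1 / k₂))
      linarith only [this]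
    rw [hEk1] at h2
    have h3 : (m : ℝ) * (m₀' * E ^ (1 / k₂)) ≤ 3 * m₀' * E ^ (1 / k₁) := by
      have h2' : ((m : ℝ) * (m₀' * E ^ (1 / k₂))) * tE ≤ (3 * m₀' * E ^ (1 / k₁)) * tE := by
        linarith only [h2]
      exact le_of_mul_le_mul_right h2' htE0
    have h4 : 3 * m₀' * E ^ (1 / k₁) ≤ δp * E ^ (1 / k₁) :=
      mul_le_mul_of_nonneg_right hm₀'p (Real.rpow_nonneg hE0.le _)
    linarith only [h1, h3, h4]
  have hτsmall : τ ≤ m' ^ 2 / 2 := by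
    refine hτ2.trans ?_
    -- `2 Λ₀ t_E = (s/2) E^{1/k₂-1/2} ≤ m₁² E^{2/k₂} / 2` iff `s E^{-1/2-1/k₂} ≤ m₁²`
    have h1 : tstar * E ^ (-(1 / 2 + 1 / k₂)) * E ^ (2 / k₂) = tstar * tE := by
      show tstar * E ^ (-(1 / 2 + 1 / k₂)) * E ^ (2 / k₂) = tstar * timeScale k₂ E
      rw [timeScale, mul_assoc, ← Real.rpow_add hE0]
      congr 2; ring
    have h2 : m' ^ 2 = m₁ ^ 2 * E ^ (2 / k₂) := by
      rw [hm', mul_pow]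
      congr 1
      rw [← Real.rpow_natCast, ← Real.rpow_mul hE0.le]
      congr 1; push_cast; ring
    have h3 : tstar * tE ≤ m₁ ^ 2 * E ^ (2 / k₂) := by
      rw [← h1]
      exact mul_le_mul_of_nonneg_right hsmall.le (Real.rpow_nonneg hE0.le _)
    rw [h2, hΛ₀]
    linarith only [h3]
  ----------------------------------------------------------------
  -- Step 2: the events
  ----------------------------------------------------------------
  set G := P.rbEnergy N with hG
  have hGm : Measurable G := (P.contDiff_rbEnergy hU.1 hV.1 N).continuous.measurable
  have hsolm : ∀ t : ℝ, Measurable fun ω : WienerPair => P.rbSolMap Λ N T_L T_R t x (pairPath ω) :=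
    fun t => OscillatorChain.measurable_rbSolMap_pairPath_right hU hV hk1 hk2 hγ0 Λ N T_L T_R t x
  set z : ℕ → WienerPair → RBPhaseSpace N := fun j ω => P.rbSolMap Λ N T_L T_R (j * τ) x (pairPath ω) with hz
  have hzm : ∀ j, Measurable (z j) := fun j => hsolm _
  set F : WienerPair → ℝ≥0∞ := fun ω =>
    ENNReal.ofReal (Real.exp (θ * G (P.rbSolMap Λ N T_L T_R tstar x (pairPath ω)))) with hF
  have hFm : Measurable F := ENNReal.measurable_ofReal.comp (Real.measurable_exp.comp
    ((hGm.comp (hsolm tstar)).const_mul _))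
  set Γ : WienerPair → ℝ := fun ω => P.rbDissipation Λ N x (P.rbEta N T_L T_R (pairPath ω)) tstar with hΓ
  have hΓm : Measurable Γ := rb_measurable_dissipation_pairPath hU hV hk1 hk2 hγ0 Λ N tstar x
  set g : ℝ := P.γ * ε₀ * E ^ (2 / k₂) / 6 with hg
  set SΓ : Set WienerPair := {ω | g ≤ Γ ω} with hSΓ
  have hSΓm : MeasurableSet SΓ := measurableSet_le measurable_const hΓm
  set D : ℕ → Set WienerPair := fun j => {ω | G (z j ω) < E / 2} with hD
  have hDm : ∀ j, MeasurableSet (D j) := fun j => measurableSet_lt (hGm.comp (hzm j)) measurable_const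
  set U : ℕ → Set WienerPair := fun j => {ω | 3 * E / 2 < G (z j ω)} with hUdef
  have hUm : ∀ j, MeasurableSet (U j) := fun j => measurableSet_lt measurable_const (hGm.comp (hzm j))
  set Nb : ℕ → Set WienerPair := fun j =>
    {ω | pairShift ((j : ℝ) * τ).toNNReal ω ∉ goodPaths m' τ.toNNReal} with hNb
  have hNbm : ∀ j, MeasurableSet (Nb j) := fun j =>
    ((measurable_pairShift (s := ((j : ℝ) * τ).toNNReal)) (measurableSet_goodPaths m' τ.toNNReal)).compl
  set S₃ : Set WienerPair := (⋃ j ∈ range (J + 1), U j) ∪ (⋃ j ∈ range J, Nb j) with hS₃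
  have hS₃m : MeasurableSet S₃ := (Finset.measurableSet_biUnion _ fun j _ => hUm j).union
    (Finset.measurableSet_biUnion _ fun j _ => hNbm j)
  ----------------------------------------------------------------
  -- Step 3: off `S₃` and the `D_j`, the dissipation is at least `g` (sure)
  ----------------------------------------------------------------
  have hcover : ∀ ω, ω ∉ S₃ → (∀ j ∈ range (J + 1), ω ∉ D j) → ω ∈ SΓ := by
    intro ω h3 hD'
    simp only [hS₃, Set.mem_union, Set.mem_iUnion, not_or, not_exists, exists_prop, not_and] at h3
    obtain ⟨hU', hNb'⟩ := h3
    have hgrid : ∀ j : ℕ, j < J → E / 2 ≤ P.rbEnergy N (P.rbSolMap Λ N T_L T_R (j * τ) x (pairPath ω)) ∧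
        P.rbEnergy N (P.rbSolMap Λ N T_L T_R (j * τ) x (pairPath ω)) ≤ 3 * E / 2 := by
      intro j hj
      have hj' : j ∈ range (J + 1) := mem_range.2 (by omega)
      have h1 := hD' j hj'
      have h2 := hU' j hj'
      simp only [hD, hUdef, hz, Set.mem_setOf_eq, not_lt] at h1 h2
      exact ⟨h1, h2⟩
    have hgood : ∀ j : ℕ, j < J → pairShift ((j : ℝ) * τ).toNNReal ω ∈ goodPaths m' τ.toNNReal := by
      intro j hj
      have := hNb' j (mem_range.2 hj)
      simpa only [hNb, Set.mem_setOf_eq, not_not] using this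
    have hdis := rb_grid_dissipation_ge_twoScale hU hV hk1 hk2 hγ0 Λ N T_L T_R hFi hFp hcell' hεi.le hεp.le
      hEEi hEEp hEE₁ hE0.le hτ0 hτ1 hτ2 hm1 hmτ hnoise hm₀'i hnoise_p x J ω hgrid hgood
    rw [hJτ] at hdis
    show g ≤ Γ ω
    refine le_trans ?_ hdis
    -- `min(d_i, d_p/m) ≥ ρ₁ = γ ε₀ E^{2/k₂} t_E/3` and `2 t_E (J - m) ≥ 1`
    have hE2k0 : 0 < E ^ (2 / k₂) := Real.rpow_pos_of_pos hE0 _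
    have h3k2 : E ^ (3 / k₂ - 1 / 2) = E ^ (2 / k₂) * tE := by
      rw [htE, timeScale, ← Real.rpow_add hE0]; congr 1; ring
    have h3k1 : E ^ (3 / k₁ - 1 / 2) = E ^ (2 / k₁) * tP := by
      rw [htP, timeScale, ← Real.rpow_add hE0]; congr 1; ring
    have h2k : E ^ (2 / k₂) ≤ E ^ (2 / k₁) := Real.rpow_le_rpow_of_exponent_le hE1 (by
      rw [div_le_div_iff₀ hk0 hk10]; linarith)
    have hε₀i : ε₀ ≤ εi := min_le_left _ _
    have hε₀p : ε₀ ≤ εp := min_le_right _ _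
    set ρ₁ : ℝ := P.γ * ε₀ * E ^ (2 / k₂) * tE / 3 with hρ₁
    have hbase : 0 ≤ P.γ * E ^ (2 / k₂) := by positivity
    have hρ₁i : ρ₁ ≤ P.γ * (εi * E ^ (3 / k₂ - 1 / 2)) := by
      rw [h3k2, hρ₁]
      have : P.γ * ε₀ * E ^ (2 / k₂) * tE ≤ P.γ * εi * E ^ (2 / k₂) * tE := by
        have := mul_le_mul_of_nonneg_left hε₀i (mul_nonneg hbase htE0.le)
        linarith only [this]
      have h0 : 0 ≤ P.γ * εi * E ^ (2 / k₂) * tE := by positivity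
      linarith only [this, h0]
    have hρ₁p : ρ₁ ≤ P.γ * (εp * E ^ (3 / k₁ - 1 / 2)) / m := by
      rw [le_div_iff₀ hm0, h3k1, hρ₁]
      -- `ρ₁ m = γ ε₀ E^{2/k₂} (m t_E)/3 ≤ γ ε₀ E^{2/k₂} t_p ≤ γ ε_p E^{2/k₁} t_p`
      have h1 : P.γ * ε₀ * E ^ (2 / k₂) * ((m : ℝ) * tE) ≤ P.γ * ε₀ * E ^ (2 / k₂) * (3 * tP) :=
        mul_le_mul_of_nonneg_left hmtE (by positivity)
      have h2 : P.γ * ε₀ * E ^ (2 / k₂) * tP ≤ P.γ * εp * E ^ (2 / k₁) * tP := by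
        have a : ε₀ * E ^ (2 / k₂) ≤ εp * E ^ (2 / k₁) :=
          mul_le_mul hε₀p h2k hE2k0.le hεp.le
        have := mul_le_mul_of_nonneg_left a (mul_nonneg hγ0 htP0.le)
        linarith only [this]
      calc P.γ * ε₀ * E ^ (2 / k₂) * tE / 3 * m = P.γ * ε₀ * E ^ (2 / k₂) * ((m : ℝ) * tE) / 3 := by ring
        _ ≤ P.γ * ε₀ * E ^ (2 / k₂) * (3 * tP) / 3 := by linarith only [h1]
        _ = P.γ * ε₀ * E ^ (2 / k₂) * tP := by ring
        _ ≤ P.γ * (εp * (E ^ (2 / k₁) * tP)) := by linarith only [h2]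
    have hkey : 1 ≤ 2 * tE * ((J : ℝ) - m) := by
      have h1 : ((J : ℝ) - m) * τ ≤ ((J : ℝ) - m) * (2 * Λ₀ * tE) := mul_le_mul_of_nonneg_left hτ2 hJm0
      have h2 : Λ₀ * 1 ≤ Λ₀ * (2 * tE * ((J : ℝ) - m)) := by linarith only [hJm, h1]
      exact le_of_mul_le_mul_left h2 hΛ₀0
    calc g = (P.γ * ε₀ * E ^ (2 / k₂) / 3) * (1 / 2) := by rw [hg]; ring
      _ ≤ (P.γ * ε₀ * E ^ (2 / k₂) / 3) * (tE * ((J : ℝ) - m)) :=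
          mul_le_mul_of_nonneg_left (by linarith only [hkey]) (by positivity)
      _ = ((J : ℝ) - m) * ρ₁ := by rw [hρ₁]; ring
      _ ≤ ((J : ℝ) - m) * min (P.γ * (εi * E ^ (3 / k₂ - 1 / 2))) (P.γ * (εp * E ^ (3 / k₁ - 1 / 2)) / m) :=
          mul_le_mul_of_nonneg_left (le_min hρ₁i hρ₁p) hJm0
  -- pointwise domination of `F`
  have hdom : ∀ ω, F ω ≤ SΓ.indicator F ω + (∑ j ∈ range (J + 1), (D j).indicator F ω) + S₃.indicator F ω := by
    intro ω
    by_cases h3 : ω ∈ S₃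
    · rw [Set.indicator_of_mem h3]
      exact le_add_self
    · by_cases hD' : ∃ j ∈ range (J + 1), ω ∈ D j
      · obtain ⟨j, hj, hωj⟩ := hD'
        have : F ω ≤ ∑ j ∈ range (J + 1), (D j).indicator F ω := by
          calc F ω = (D j).indicator F ω := (Set.indicator_of_mem hωj F).symm
            _ ≤ ∑ j ∈ range (J + 1), (D j).indicator F ω :=
                Finset.single_le_sum (f := fun j => (D j).indicator F ω) (fun _ _ => bot_le) hj
        exact this.trans (le_add_left le_rfl |>.trans (le_add_right le_rfl))
      · push Not at hD'
        rw [Set.indicator_of_mem (hcover ω h3 hD')]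
        exact le_add_right (le_add_right le_rfl)
  ----------------------------------------------------------------
  -- Step 4: the three integral bounds
  ----------------------------------------------------------------
  -- (T1) large dissipation: the exponential supermartingale ((41))
  have hT1 : ∫⁻ ω, SΓ.indicator F ω ∂wienerPair ≤
      ENNReal.ofReal (Real.exp (-(κ * g)) * Real.exp (θ * E + Cst * tstar)) := by
    have hpt : ∀ ω, SΓ.indicator F ω ≤ ENNReal.ofReal (Real.exp (-(κ * g))) *
        ENNReal.ofReal (Real.exp (θ * G (P.rbSolMap Λ N T_L T_R tstar x (pairPath ω)) + κ * Γ ω)) := by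
      intro ω
      by_cases hω : ω ∈ SΓ
      · rw [Set.indicator_of_mem hω, hF, ← ENNReal.ofReal_mul (Real.exp_pos _).le, ← Real.exp_add]
        refine ENNReal.ofReal_le_ofReal (Real.exp_le_exp.2 ?_)
        have : g ≤ Γ ω := hω
        nlinarith only [this, hκ0]
      · rw [Set.indicator_of_notMem hω]; exact bot_le
    refine (lintegral_mono hpt).trans ?_
    have hm2 : Measurable fun ω => ENNReal.ofReal (Real.exp (θ * G (P.rbSolMap Λ N T_L T_R tstar x (pairPath ω)) + κ * Γ ω)) :=
      ENNReal.measurable_ofReal.comp (Real.measurable_exp.comp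
        (((hGm.comp (hsolm tstar)).const_mul _).add (hΓm.const_mul _)))
    rw [lintegral_const_mul _ hm2, ENNReal.ofReal_mul (Real.exp_pos _).le]
    gcongr
    have h := rb_lintegral_exp_rbEnergy_add_dissipation_le hU hV hk1 hk2 hγ0 Λ N hTL.le hTR.le θ hts.le x
    have he : Real.exp (θ * P.rbEnergy N x + θ * P.γ * (T_L + T_R) * tstar) = Real.exp (θ * E + Cst * tstar) := by
      congr 1; rw [hCst]; ring
    rw [he] at h
    simpa only [hκ] using h
  -- (T2) low grid energy: restart and (26)
  have hT2 : ∀ j ∈ range (J + 1), ∫⁻ ω, (D j).indicator F ω ∂wienerPair ≤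
      ENNReal.ofReal (Real.exp (Cst * tstar) * Real.exp (θ * E / 2)) := by
    intro j hj
    have hj' := mem_range.1 hj
    set B : Set (RBPhaseSpace N) := {y | G y < E / 2} with hB
    have hBm : MeasurableSet B := measurableSet_lt hGm measurable_const
    have hind : ∀ ω, (D j).indicator F ω = B.indicator 1 (z j ω) * F ω := fun ω => by
      by_cases hω : ω ∈ D j
      · have : z j ω ∈ B := hω
        rw [Set.indicator_of_mem hω, Set.indicator_of_mem this, Pi.one_apply, one_mul]
      · have : z j ω ∉ B := hω
        rw [Set.indicator_of_notMem hω, Set.indicator_of_notMem this, zero_mul]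
    simp_rw [hind]
    have hu : 0 ≤ tstar - j * τ := by linarith only [hjτ j hj']
    have hsj : (((j : ℝ) * τ).toNNReal : ℝ) = j * τ := Real.coe_toNNReal _ (by positivity)
    have hR := rb_lintegral_indicator_exp_rbEnergy_restart_le hU hV hk1 hk2 hγ0 Λ N hTL hTR hθ hθ'
      ((j : ℝ) * τ).toNNReal hu x hBm
    rw [hsj, show (j : ℝ) * τ + (tstar - j * τ) = tstar by ring] at hR
    refine hR.trans ?_
    have hpt : ∀ ω, B.indicator 1 (P.rbSolMap Λ N T_L T_R (j * τ) x (pairPath ω)) *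
        ENNReal.ofReal (Real.exp (θ * P.rbEnergy N (P.rbSolMap Λ N T_L T_R (j * τ) x (pairPath ω)))) ≤
        ENNReal.ofReal (Real.exp (θ * E / 2)) := by
      intro ω
      by_cases hω : P.rbSolMap Λ N T_L T_R (j * τ) x (pairPath ω) ∈ B
      · rw [Set.indicator_of_mem hω, Pi.one_apply, one_mul]
        refine ENNReal.ofReal_le_ofReal (Real.exp_le_exp.2 ?_)
        have : G (P.rbSolMap Λ N T_L T_R (j * τ) x (pairPath ω)) < E / 2 := hω
        nlinarith only [this, hθ]
      · rw [Set.indicator_of_notMem hω, zero_mul]; exact bot_le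
    calc ENNReal.ofReal (Real.exp (Cst * (tstar - j * τ))) *
          ∫⁻ ω, B.indicator 1 (P.rbSolMap Λ N T_L T_R (j * τ) x (pairPath ω)) *
            ENNReal.ofReal (Real.exp (θ * P.rbEnergy N (P.rbSolMap Λ N T_L T_R (j * τ) x (pairPath ω)))) ∂wienerPair
        ≤ ENNReal.ofReal (Real.exp (Cst * tstar)) * ∫⁻ _ω, ENNReal.ofReal (Real.exp (θ * E / 2)) ∂wienerPair := by
          refine mul_le_mul' (ENNReal.ofReal_le_ofReal (Real.exp_le_exp.2 ?_)) (lintegral_mono hpt)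
          have : tstar - j * τ ≤ tstar := by
            have : (0 : ℝ) ≤ j * τ := by positivity
            linarith only [this]
          exact mul_le_mul_of_nonneg_left this hCst0
      _ = _ := by
          rw [lintegral_const, measure_univ, mul_one, ← ENNReal.ofReal_mul (Real.exp_pos _).le]
  -- (T3) the bad events: Hölder, Chebyshev and the Brownian oscillation tail
  have hU_le : ∀ j ∈ range (J + 1), wienerPair (U j) ≤
      ENNReal.ofReal (Real.exp (-(θ * (3 * E / 2))) * (Real.exp (Cst * tstar) * Real.exp (θ * E))) := by
    intro j hj
    have hj' := mem_range.1 hj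
    have hsj : (((j : ℝ) * τ).toNNReal : ℝ) = j * τ := Real.coe_toNNReal _ (by positivity)
    have h := rb_measure_lt_rbEnergy_rbSolMap_le hU hV hk1 hk2 hγ0 Λ N hTL hTR hθ hθ'
      ((j : ℝ) * τ).toNNReal x (3 * E / 2)
    rw [hsj] at h
    refine h.trans (ENNReal.ofReal_le_ofReal ?_)
    refine mul_le_mul_of_nonneg_left (mul_le_mul_of_nonneg_right (Real.exp_le_exp.2 ?_) (Real.exp_pos _).le)
      (Real.exp_pos _).le
    exact mul_le_mul_of_nonneg_left (hjτ j hj') hCst0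
  have hNb_le : ∀ j ∈ range J, wienerPair (Nb j) ≤
      2 * ENNReal.ofReal (2 * τ ^ 2 / (m' ^ 2 - τ) ^ 2) := by
    intro j _
    have h := measure_pairShift_not_mem_goodPaths ((j : ℝ) * τ).toNNReal m' τ.toNNReal
    simp only [hNb]
    rw [h]
    have hτ' : ((τ.toNNReal : ℝ≥0) : ℝ) = τ := Real.coe_toNNReal τ hτ0.le
    have hlt : ((τ.toNNReal : ℝ≥0) : ℝ) < m' ^ 2 := by
      rw [hτ']
      have : 0 < m' ^ 2 := by positivity
      linarith only [hτsmall, this]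
    have := measure_compl_goodEvent_le hm'0 τ.toNNReal hlt
    rwa [hτ'] at this
  set u₁ : ℝ := Real.exp (-(θ * (3 * E / 2))) * (Real.exp (Cst * tstar) * Real.exp (θ * E)) with hu₁
  set u₂ : ℝ := 2 * τ ^ 2 / (m' ^ 2 - τ) ^ 2 with hu₂
  have hu₁0 : 0 ≤ u₁ := by positivity
  have hu₂0 : 0 ≤ u₂ := by positivity
  set Y : ℝ := (J + 1) * u₁ + J * (2 * u₂) with hY
  have hY0 : 0 ≤ Y := by positivity
  have hJ' : ENNReal.ofReal ((J : ℝ) + 1) = (J : ℝ≥0∞) + 1 := by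
    rw [ENNReal.ofReal_add (Nat.cast_nonneg J) zero_le_one, ENNReal.ofReal_natCast, ENNReal.ofReal_one]
  have hS₃_le : wienerPair S₃ ≤ ENNReal.ofReal Y := by
    calc wienerPair S₃ ≤ wienerPair (⋃ j ∈ range (J + 1), U j) + wienerPair (⋃ j ∈ range J, Nb j) :=
          measure_union_le _ _
      _ ≤ (∑ j ∈ range (J + 1), wienerPair (U j)) + ∑ j ∈ range J, wienerPair (Nb j) :=
          add_le_add (measure_biUnion_finset_le _ _) (measure_biUnion_finset_le _ _)
      _ ≤ (∑ j ∈ range (J + 1), ENNReal.ofReal u₁) + ∑ j ∈ range J, 2 * ENNReal.ofReal u₂ :=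
          add_le_add (Finset.sum_le_sum hU_le) (Finset.sum_le_sum hNb_le)
      _ = ENNReal.ofReal Y := by
          rw [Finset.sum_const, Finset.sum_const, card_range, card_range, nsmul_eq_mul, nsmul_eq_mul, hY,
            ENNReal.ofReal_add (by positivity : 0 ≤ ((J : ℝ) + 1) * u₁) (by positivity : 0 ≤ (J : ℝ) * (2 * u₂)),
            ENNReal.ofReal_mul (by positivity : 0 ≤ (J : ℝ) + 1), ENNReal.ofReal_mul (Nat.cast_nonneg J),
            ENNReal.ofReal_mul (by norm_num : (0 : ℝ) ≤ 2), ENNReal.ofReal_ofNat, ENNReal.ofReal_natCast, hJ']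
          push_cast
          rfl
  have hT3 : ∫⁻ ω, S₃.indicator F ω ∂wienerPair ≤
      ENNReal.ofReal (Real.exp (Cst * tstar) * Real.exp (θ * E)) * ENNReal.ofReal Y ^ (1 / q) := by
    have hind : ∀ ω, S₃.indicator F ω = S₃.indicator 1 ω * F ω := fun ω => by
      by_cases hω : ω ∈ S₃
      · rw [Set.indicator_of_mem hω, Set.indicator_of_mem hω, Pi.one_apply, one_mul]
      · rw [Set.indicator_of_notMem hω, Set.indicator_of_notMem hω, zero_mul]
    simp_rw [hind]
    have h := rb_lintegral_indicator_exp_rbEnergy_le_rpow hU hV hk1 hk2 hγ0 Λ N hTL hTR hθ hp1 hpθ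
      tstar.toNNReal x hS₃m
    rw [Real.coe_toNNReal tstar hts.le] at h
    refine h.trans ?_
    rw [← hq]
    gcongr
  ----------------------------------------------------------------
  -- Step 5: assemble
  ----------------------------------------------------------------
  have hsum : ∫⁻ ω, F ω ∂wienerPair ≤
      ENNReal.ofReal (Real.exp (-(κ * g)) * Real.exp (θ * E + Cst * tstar)) +
      (J + 1) * ENNReal.ofReal (Real.exp (Cst * tstar) * Real.exp (θ * E / 2)) +
      ENNReal.ofReal (Real.exp (Cst * tstar) * Real.exp (θ * E)) * ENNReal.ofReal Y ^ (1 / q) := by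
    calc ∫⁻ ω, F ω ∂wienerPair
        ≤ ∫⁻ ω, (SΓ.indicator F ω + (∑ j ∈ range (J + 1), (D j).indicator F ω) + S₃.indicator F ω) ∂wienerPair :=
          lintegral_mono hdom
      _ = (∫⁻ ω, SΓ.indicator F ω ∂wienerPair) + (∑ j ∈ range (J + 1), ∫⁻ ω, (D j).indicator F ω ∂wienerPair) +
            ∫⁻ ω, S₃.indicator F ω ∂wienerPair := by
          rw [lintegral_add_right _ (hFm.indicator hS₃m), lintegral_add_left (hFm.indicator hSΓm),
            lintegral_finsetSum _ fun j _ => hFm.indicator (hDm j)]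
      _ ≤ _ := by
          refine add_le_add (add_le_add hT1 ?_) hT3
          calc ∑ j ∈ range (J + 1), ∫⁻ ω, (D j).indicator F ω ∂wienerPair
              ≤ ∑ j ∈ range (J + 1), ENNReal.ofReal (Real.exp (Cst * tstar) * Real.exp (θ * E / 2)) :=
                Finset.sum_le_sum hT2
            _ = _ := by rw [Finset.sum_const, card_range, nsmul_eq_mul]; push_cast; ring
  -- everything as one real number
  set X₁ : ℝ := Real.exp (-(κ * g)) * Real.exp (θ * E + Cst * tstar) with hX₁
  set X₂ : ℝ := Real.exp (Cst * tstar) * Real.exp (θ * E / 2) with hX₂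
  set X₃ : ℝ := Real.exp (Cst * tstar) * Real.exp (θ * E) with hX₃
  have hX₁0 : 0 ≤ X₁ := by rw [hX₁]; positivity
  have hX₂0 : 0 ≤ X₂ := by rw [hX₂]; positivity
  have hX₃0 : 0 ≤ X₃ := by rw [hX₃]; positivity
  have hreal : ENNReal.ofReal (X₁ + (J + 1) * X₂ + X₃ * Y ^ (1 / q)) =
      ENNReal.ofReal X₁ + (J + 1) * ENNReal.ofReal X₂ + ENNReal.ofReal X₃ * ENNReal.ofReal Y ^ (1 / q) := by
    have h1 : 0 ≤ ((J : ℝ) + 1) * X₂ := by positivity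
    have h2 : 0 ≤ X₃ * Y ^ (1 / q) := mul_nonneg hX₃0 (Real.rpow_nonneg hY0 _)
    have h3 : 0 ≤ X₁ + ((J : ℝ) + 1) * X₂ := add_nonneg hX₁0 h1
    rw [ENNReal.ofReal_add h3 h2, ENNReal.ofReal_add hX₁0 h1, ENNReal.ofReal_mul (by positivity : 0 ≤ (J : ℝ) + 1),
      ENNReal.ofReal_mul hX₃0, ENNReal.ofReal_rpow_of_nonneg hY0 hq0.le, hJ']
  ----------------------------------------------------------------
  -- Step 6: the real inequality `X₁ + (J+1)X₂ + X₃ Y^{1/q} ≤ e^{θE} Bf(E) ≤ e^{θE}/2`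
  ----------------------------------------------------------------
  have hEexp : Real.exp (θ * E) * Real.exp (-(θ / 2 * E)) = Real.exp (θ * E / 2) := by
    rw [← Real.exp_add]; congr 1; ring
  have hterm1 : X₁ = Real.exp (θ * E) * (Real.exp (Cst * tstar) * Real.exp (-(κ * P.γ * ε₀ / 6 * E ^ (2 / k₂)))) := by
    rw [hX₁, hg, Real.exp_add]
    have : -(κ * (P.γ * ε₀ * E ^ (2 / k₂) / 6)) = -(κ * P.γ * ε₀ / 6 * E ^ (2 / k₂)) := by ring
    rw [this]; ring
  have hterm2 : (J + 1) * X₂ ≤ Real.exp (θ * E) * ((4 * E + 1) * Real.exp (Cst * tstar) * Real.exp (-(θ / 2 * E))) := by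
    rw [hX₂, ← hEexp]
    have h0 : 0 ≤ Real.exp (Cst * tstar) * (Real.exp (θ * E) * Real.exp (-(θ / 2 * E))) := by positivity
    calc ((J : ℝ) + 1) * (Real.exp (Cst * tstar) * (Real.exp (θ * E) * Real.exp (-(θ / 2 * E))))
        ≤ (4 * E + 1) * (Real.exp (Cst * tstar) * (Real.exp (θ * E) * Real.exp (-(θ / 2 * E)))) :=
          mul_le_mul_of_nonneg_right (by linarith only [hJr]) h0
      _ = _ := by ring
  -- `J · 2u₂ ≤ C₂ E^{-2/k₂}`
  have hu₂_le : u₂ ≤ 32 * Λ₀ ^ 2 * tE ^ 2 / m' ^ 4 := by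
    rw [hu₂]
    have hden : m' ^ 2 / 2 ≤ m' ^ 2 - τ := by linarith only [hτsmall]
    have hden0 : 0 < m' ^ 2 / 2 := by positivity
    have h1 : 2 * τ ^ 2 / (m' ^ 2 - τ) ^ 2 ≤ 2 * τ ^ 2 / (m' ^ 2 / 2) ^ 2 := by
      refine div_le_div_of_nonneg_left (by positivity) (by positivity) ?_
      exact pow_le_pow_left₀ hden0.le hden 2
    refine h1.trans ?_
    have hτ2' : τ ^ 2 ≤ (2 * Λ₀ * tE) ^ 2 := pow_le_pow_left₀ hτ0.le hτ2 2
    have hm'p : 0 < m' := by positivity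
    rw [div_le_div_iff₀ (by positivity) (by positivity)]
    have : 2 * τ ^ 2 * m' ^ 4 ≤ 2 * (2 * Λ₀ * tE) ^ 2 * m' ^ 4 :=
      mul_le_mul_of_nonneg_right (by linarith only [hτ2']) (by positivity)
    refine this.trans (le_of_eq ?_)
    ring
  have hJu₂ : (J : ℝ) * (2 * u₂) ≤ C₂ * E ^ (-(2 / k₂)) := by
    have hm'4 : m' ^ 4 = m₁ ^ 4 * (E ^ (2 / k₂) * E ^ (2 / k₂)) := by
      rw [hm', mul_pow]
      congr 1
      rw [← Real.rpow_add hE0, ← Real.rpow_natCast, ← Real.rpow_mul hE0.le]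
      congr 1; push_cast; ring
    have hEt : E * tE ^ 2 = E ^ (2 / k₂) := by
      have hne : 1 + (1 / k₂ - 1 / 2 + (1 / k₂ - 1 / 2)) ≠ 0 := by intro h; linarith only [h, hk']
      show E * timeScale k₂ E ^ 2 = E ^ (2 / k₂)
      rw [timeScale, sq, ← Real.rpow_add hE0, ← Real.rpow_one_add' hE0.le hne]
      congr 1; ring
    have hE2k : 0 < E ^ (2 / k₂) := Real.rpow_pos_of_pos hE0 _
    have hneg : E ^ (-(2 / k₂)) = (E ^ (2 / k₂))⁻¹ := Real.rpow_neg hE0.le _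
    calc (J : ℝ) * (2 * u₂) ≤ (4 * E) * (2 * (32 * Λ₀ ^ 2 * tE ^ 2 / m' ^ 4)) :=
          mul_le_mul hJr (by linarith only [hu₂_le]) (by positivity) (by positivity)
      _ = 256 * Λ₀ ^ 2 * (E * tE ^ 2) / m' ^ 4 := by ring
      _ = C₂ * E ^ (-(2 / k₂)) := by
          rw [hEt, hm'4, hC₂, hneg]
          field_simp
  have hY_le : Y ≤ (4 * E + 1) * Real.exp (Cst * tstar) * Real.exp (-(θ / 2 * E)) + C₂ * E ^ (-(2 / k₂)) := by
    rw [hY]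
    refine add_le_add ?_ hJu₂
    rw [hu₁]
    have he : Real.exp (-(θ * (3 * E / 2))) * (Real.exp (Cst * tstar) * Real.exp (θ * E)) =
        Real.exp (Cst * tstar) * Real.exp (-(θ / 2 * E)) := by
      rw [mul_comm, mul_assoc, ← Real.exp_add]; congr 1; ring_nf
    rw [he]
    have h0 : 0 ≤ Real.exp (Cst * tstar) * Real.exp (-(θ / 2 * E)) := by positivity
    calc ((J : ℝ) + 1) * (Real.exp (Cst * tstar) * Real.exp (-(θ / 2 * E)))
        ≤ (4 * E + 1) * (Real.exp (Cst * tstar) * Real.exp (-(θ / 2 * E))) :=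
          mul_le_mul_of_nonneg_right (by linarith only [hJr]) h0
      _ = _ := by ring
  have hterm3 : X₃ * Y ^ (1 / q) ≤ Real.exp (θ * E) * (Real.exp (Cst * tstar) *
      ((4 * E + 1) * Real.exp (Cst * tstar) * Real.exp (-(θ / 2 * E)) + C₂ * E ^ (-(2 / k₂))) ^ (1 / q)) := by
    rw [hX₃]
    have hrp := Real.rpow_le_rpow hY0 hY_le hq0.le
    calc Real.exp (Cst * tstar) * Real.exp (θ * E) * Y ^ (1 / q)
        ≤ Real.exp (Cst * tstar) * Real.exp (θ * E) *
            ((4 * E + 1) * Real.exp (Cst * tstar) * Real.exp (-(θ / 2 * E)) + C₂ * E ^ (-(2 / k₂))) ^ (1 / q) :=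
          mul_le_mul_of_nonneg_left hrp (by positivity)
      _ = _ := by ring
  have hfinal : X₁ + (J + 1) * X₂ + X₃ * Y ^ (1 / q) ≤ Real.exp (θ * E) * Bf E := by
    rw [hterm1, hBf]
    simp only
    nlinarith only [hterm2, hterm3, Real.exp_pos (θ * E)]
  have hhalf : Real.exp (θ * E) * Bf E ≤ Real.exp (θ * E) / 2 := by
    have := hBa.le
    nlinarith only [this, Real.exp_pos (θ * E)]
  calc ∫⁻ ω, F ω ∂wienerPair ≤ _ := hsum
    _ = ENNReal.ofReal (X₁ + (J + 1) * X₂ + X₃ * Y ^ (1 / q)) := hreal.symm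
    _ ≤ ENNReal.ofReal (Real.exp (θ * E) / 2) := ENNReal.ofReal_le_ofReal (hfinal.trans hhalf)

end MainTwoScale


/-! ### Theorem 3.10 for the constructed kernels, `k₁ < k₂` and in general -/

section Thm310TwoScale

variable {P : OscillatorChain} {k₁ k₂ : ℝ} (hU : RBGrowth P.U k₁) (hV : RBGrowth P.V k₂)
  (hk₁2 : 2 ≤ k₁) (hk : k₁ < k₂) (hγ : 0 < P.γ) {Λ : ℝ} (hΛ : Λ ≠ 0) (hN : 0 < N)
  {T_L T_R : ℝ} (hTL : 0 < T_L) (hTR : 0 < T_R)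
include hU hV hk₁2 hk hγ hΛ hN hTL hTR

/-- **Rey-Bellet–Thomas 2002, Theorem 3.10 (the Liapunov bound (39)), PROVED for `k₁ < k₂`**:
for the transition kernels `rbKernel` of (RBT-SDE) with H1–H2, pinning exponent `2 ≤ k₁` strictly
smaller than the interaction exponent `k₂`, `γ > 0`, `Λ ≠ 0`, `N ≥ 1`, `T_L, T_R > 0`: for every
`s > 0` and `0 < θ < 1/max(T_L, T_R)` there are a compact `U = {G ≤ E₀}`, `κ = ½ < 1` and
`L = e^{γ(T_L+T_R)θs} e^{θE₀}` with `T^s e^{θG}(x) ≤ κ e^{θG(x)} + L 1_U(x)` for all `x` ((26) on `U`,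
`rb_lintegral_exp_rbEnergy_small_twoScale` off `U`; the two-time-scale repair of CEHR 2018 §5).
[cite: ReyBelletThomas2002, Thm 3.10] -/
theorem OscillatorChain.rb_thm310_twoScale :
    ∀ s : ℝ≥0, 0 < s → ∀ θ : ℝ, 0 < θ → θ < 1 / max T_L T_R →
      ∃ (U : Set (RBPhaseSpace N)) (κ L : ℝ), IsCompact U ∧ κ < 1 ∧
        ∀ x, ∫⁻ y, ENNReal.ofReal (Real.exp (θ * P.rbEnergy N y)) ∂(P.rbKernel Λ N T_L T_R s x) ≤
          ENNReal.ofReal (κ * Real.exp (θ * P.rbEnergy N x) + L * U.indicator 1 x) := by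
  intro s hs θ hθ hθ'
  have hk1 : 1 ≤ k₁ := by linarith
  have hk2 : 1 ≤ k₂ := by linarith
  obtain ⟨E₀, hE₀⟩ := rb_lintegral_exp_rbEnergy_small_twoScale hU hV hk₁2 hk hγ hΛ hN hTL hTR hθ hθ' (tstar := (s : ℝ))
    (by exact_mod_cast hs)
  set U : Set (RBPhaseSpace N) := {z | P.rbEnergy N z ≤ E₀} with hUdef
  set L : ℝ := Real.exp (P.γ * (T_L + T_R) * θ * s) * Real.exp (θ * E₀) with hL
  have hmeas := rb_measurable_exp_rbEnergy hU hV hk1 hk2 hγ.le N hTL hTR hθ hθ'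
  refine ⟨U, 1 / 2, L, P.isCompact_setOf_rbEnergy_le hU hV hk1 hk2 N E₀, by norm_num, fun x => ?_⟩
  rw [OscillatorChain.lintegral_rbKernel hU hV hk1 hk2 hγ.le Λ N T_L T_R s x hmeas]
  by_cases hx : x ∈ U
  · have h26 := rb_lintegral_exp_rbEnergy_rbSolMap_le hU hV hk1 hk2 hγ.le Λ N hTL hTR hθ hθ' s x
    refine h26.trans (ENNReal.ofReal_le_ofReal ?_)
    rw [Set.indicator_of_mem hx, Pi.one_apply, mul_one]
    have hxE : P.rbEnergy N x ≤ E₀ := hx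
    have h1 : Real.exp (P.γ * (T_L + T_R) * θ * s) * Real.exp (θ * P.rbEnergy N x) ≤ L := by
      rw [hL]
      exact mul_le_mul_of_nonneg_left (Real.exp_le_exp.2 (mul_le_mul_of_nonneg_left hxE hθ.le)) (Real.exp_pos _).le
    have h2 : 0 ≤ 1 / 2 * Real.exp (θ * P.rbEnergy N x) := by positivity
    linarith only [h1, h2]
  · have hxE : E₀ ≤ P.rbEnergy N x := le_of_lt (not_le.1 hx)
    refine (hE₀ x hxE).trans (ENNReal.ofReal_le_ofReal ?_)
    rw [Set.indicator_of_notMem hx, mul_zero, add_zero]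
    linarith only [Real.exp_pos (θ * P.rbEnergy N x)]

end Thm310TwoScale

/-- **Rey-Bellet–Thomas 2002, Theorem 3.10, PROVED for all `2 ≤ k₁ ≤ k₂`** (the case `k₁ = k₂`
is the tree's `rb_thm310`, the printed single-scale proof; the case `k₁ < k₂` is
`rb_thm310_twoScale`). [cite: ReyBelletThomas2002, Thm 3.10] -/
theorem OscillatorChain.rb_thm310' {P : OscillatorChain} {k₁ k₂ : ℝ} (hU : RBGrowth P.U k₁)
    (hV : RBGrowth P.V k₂) (hk₁ : 2 ≤ k₁) (hk₁₂ : k₁ ≤ k₂) (hγ : 0 < P.γ) {Λ : ℝ} (hΛ : Λ ≠ 0)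
    (hN : 0 < N) {T_L T_R : ℝ} (hTL : 0 < T_L) (hTR : 0 < T_R) :
    ∀ s : ℝ≥0, 0 < s → ∀ θ : ℝ, 0 < θ → θ < 1 / max T_L T_R →
      ∃ (U : Set (RBPhaseSpace N)) (κ L : ℝ), IsCompact U ∧ κ < 1 ∧
        ∀ x, ∫⁻ y, ENNReal.ofReal (Real.exp (θ * P.rbEnergy N y)) ∂(P.rbKernel Λ N T_L T_R s x) ≤
          ENNReal.ofReal (κ * Real.exp (θ * P.rbEnergy N x) + L * U.indicator 1 x) := by
  rcases hk₁₂.eq_or_lt with h | h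
  · subst h
    exact OscillatorChain.rb_thm310 hU hV hk₁ hγ hΛ hN hTL hTR
  · exact OscillatorChain.rb_thm310_twoScale hU hV hk₁ h hγ hΛ hN hTL hTR

/-! ### Theorem 2.1 -/

/-- **Rey-Bellet–Thomas 2002, Theorem 2.1 — the named fact `ReyBelletThomas2002_thm21`, PROVED.**
Under H1–H2 (`RBGrowth U k₁`, `RBGrowth V k₂`, `2 ≤ k₁ ≤ k₂`, `RBNondegenerate V`), `γ, Λ > 0`,
`N ≥ 2`, `T_L, T_R > 0`: the constructed Markov semigroup of (RBT-SDE) has jointly `C^∞` transition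
densities, a unique invariant probability measure with a smooth everywhere positive density,
`e^{θG}`-exponential convergence and exponential decay of correlations for every
`0 < θ < 1/max(T_L, T_R)` — Theorem 3.10 (`rb_thm310'`: the printed proof for `k₁ = k₂`, the
two-time-scale repair of Cuneo–Eckmann–Hairer–Rey-Bellet 2018 §5 for `k₁ < k₂`), Prop. 4.2
(`rb_irreducible`), Hörmander's theorem (`hormander1967_thm11_proof`) and the §5 assembly
(`ReyBelletThomas2002_thm21_of_thm310`). [cite: ReyBelletThomas2002, Thm 2.1] -/
theorem ReyBelletThomas2002_thm21_holds : ReyBelletThomas2002_thm21 :=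
  ReyBelletThomas2002_thm21_of_thm310 fun _P _Λ _k₁ _k₂ hk₁ hk₁₂ hU hV _ hγ hΛ _N _T_L _T_R hN hL hR =>
    OscillatorChain.rb_thm310' hU hV hk₁ hk₁₂ hγ hΛ.ne' (by omega) hL hR

end Literature.MathematicalPhysics.KineticTheory.HeatConduction

end
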